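import Summits.QuantumFields.BalabanUV.Beta.GAN24.CombTowerEndOfLetterRows
import Summits.QuantumFields.BalabanUV.Beta.GAN24.CombTableLawsAtPin

/-!
# `BalabanUV.Beta.GAN24.CombTowerEndAtPin` — binder row G-an2-4 ∕ (CONV-C), TRANSFER-III (the (α-0) chain at row D1's literal of record (III′)):
# **THE G-an2-4 END AT ROW D1's LITERAL OF RECORD WITH THE TABLE LAWS, THEIR PARITIES AND THE TWO SCALAR ROWS DISCHARGED AT THE PINS** — the OWNER gan24-p1
# g49's (III′) END JUNCTION `CombTowerEndOfLetterRows` §2 ∕ §3 ∕ §4 (p465297 ✓ 594ff4c6f988) with its displayed classes (a) «the table laws + parities of the T₂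
# recursion at `GcombSh`» and (c) «two scalar rows `hcH ∕ hq`» SUPPLIED by MY `CombTableLawsAtPin.exists_tableLaws_parities_comb_three_at_pin` and
# `CombPinLockScalar.hcH0∕hcH∕hq_pin_three` BY NAME: what the END displays after this file is (b) the S-slot rows (hS, hSall) of `ScombOf` — or road-P2 g56's six
# S-slot contact letters — and (d) the (C)^{ev} zero-mode row, NOTHING ELSE on the G-an2-4 side (G-an2-4 CRUX TEAM (2), leaf prover
# `b2b-balaban-gan24-formalise-leaf-01`, gen 83 — crew GAN's kept leaf prover; no existing file touched)

NOT IN PRINT; OUR BOOKKEEPING ([folklore] three two-line compositions BY NAME at weight 0; the binders (b)∕(d) and the six contact letters are the END's VERBATIM with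
`cΛt := cΛ` — the order-one consistency (c1)′ at `G′` wants the record's Λ-table constant to be the slot's; 0 `def`, 0 cited facts, 0 `def … : Prop`, 0 sorry).
HONEST FRAMING (cell contract, verbatim): «discharging `BetaPertH` makes Bałaban's UV stability UNCONDITIONAL — a real constructive-QFT result; it is NOT the continuum
limit and NOT the Clay problem.»  HONEST DEPENDENCY (verbatim): «continuum YM on T⁴ ⇐ BetaPertH ∧ nine spine estimates (0/9 proved); BetaPertH ⇐ (D1) ∧ (D4) ∧
CAP+tail; G-an2-4 gates asym, D1 and NE2/3/4.»

WHAT (`Lc` odd, `2 ≤ Lc`, colour `SU(N)` with `2 ≤ N`, an1's record `symTablesAn1S2 3 Lc cΛ`, the two unit locks `cΛ·Lc⁴ = 2`, `cB = −Lc¹²∕4`; the END's pins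
`cE = Lc⁴`, `cVH = −Lc⁸∕2`, `cE₂ = Lc⁸`, `Tc = (8N²)⁻¹ • wsym22 N`; `ξ := ½`, `r := ctrOff 4 Lc`, `cH l := (stepScale 3 Lc l · Lc^{3+1})⁻¹`):
* §1 **`exists_allScalesSeq_JsB12CombShSym_an1_of_sRows_at_pin`** — `∃ κ θ, 0 ≤ θ ∧ θ < 1 ∧ AllScalesSeq (j ↦ secondMoment (TbalOf Lc (JsB12CombShSym hLc N
  (symTablesAn1S2 3 Lc cΛ) cΛ cB) j) μ ν) κ θ` ⟸ (b) the S-slot rows (hS, hSall) of `unitS_j (ScombOf … j)` ∧ (d) the (C)^{ev} row — NOTHING ELSE;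
* §2 **`d1Drift_JsB12CombShSym_an1_iff_lim_eq_of_sRows_at_pin`** — row D1's READING `D1Drift … Nc μ ν ↔ lim = stepBal Nc Lc` under the same two rows (the VALUE is row
  D1's and is NOT proved);
* §3 **`exists_allScalesSeq_JsB12CombShSym_an1_of_contactLetters_at_pin`** — §1 with (b) READ FROM road-P2 g56's six S-slot contact letters (the END's §4 binders
  `hCT hCTd hCg hPc hCv hPcV` VERBATIM): the G-an2-4 END at row D1's literal of record ⟸ six contact letters ∧ the (C)^{ev} row — NOTHING ELSE
  (default heartbeats suffice here — the END's §4 needed `400000` for its longer signature; this one is 25 displayed lines shorter).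
WHAT THIS IS NOT.  The rows (b)∕(d) ∕ the contact letters are DISPLAYED; asserts NO value of Bałaban's tables and NO value of any charge; NOT one S-∕W-slot row
discharged as a VALUE (S-slot (hS, hSall) 0∕2; the W-slot is read through T₂^{ev} ⟸ laws (now theorems) ∧ S-rows ∧ (C)^{ev}); NOTHING of (C)^{ev} ∕ (C)sym ∕ (Q-L) as
values; the (III′) campaign is NOT asked (an2 W-4 l.64553) — zero weight; NEVER «G-an2-4 closed» as (CONV-C); NOT D1, NOT `BetaPertH`, NOT continuum, NOT Clay; not
in print.  2026-08-26.
-/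

noncomputable section

open Finset
open scoped BigOperators
open Literature.MathematicalPhysics.QuantumFieldTheory
open Literature.MathematicalPhysics.QuantumFieldTheory.Balaban1983to89
open Literature.MathematicalPhysics.QuantumFieldTheory.Balaban1983to89.Beta
open RemainderConstAllScales (AllScalesSeq)
open ExpKernelCalculus (MKer comp)
open OneStepResolventKernel (Fib LocStencil)
open OneStepKernelFamily (KInvStep TbalOf D1Drift)
open SecondOrderResponse (W2SymOfK)
open KernelWard (divV)
open AffineAveraging (box toSite unitVec)
open BalabanCompositeJets (LocStencil₂ LocStencil₂.mono LocStencil₂.nonneg)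
open BalabanStepJetsSucc (mmRead)
open BalabanStepW2 (K3OfK M2Of)
open WilsonVertex2Sym (wsym22)
open Summit.QuantumFields.BalabanUV.Beta.TameKernelCalculus (trK)
open Summit.QuantumFields.BalabanUV.Beta.BorderedHessian (sgnK diagK)
open Summit.QuantumFields.BalabanUV.Beta.AveragingWardRootedStencils (legInd)
open Summit.QuantumFields.BalabanUV.Beta.HessKerDressedUnits (unitK unitS)
open Summit.QuantumFields.BalabanUV.Beta.SecondOrderUnits (unitM unitS₂ unitM₂)
open Summit.QuantumFields.BalabanUV.Beta.SpineRooted (T2RecOf)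
open Summit.QuantumFields.BalabanUV.Beta.CombChartStepJets (GcombSh ScombOf SpureCombOf)
open Summit.QuantumFields.BalabanUV.Beta.CombChartJointEnd (JsB12CombShSym)
open Summit.QuantumFields.BalabanUV.Beta.SymSecondOrderTablesAn1 (symTablesAn1S2)
open Summit.QuantumFields.BalabanUV.Beta.GAN24.CombesThomas (sfStep smStep)
open Summit.QuantumFields.BalabanUV.Beta.GAN24.T2RecursionAffine (lin4)
open Summit.QuantumFields.BalabanUV.Beta.GAN24.BiStencilZeroMode (zmode)
open Summit.QuantumFields.BalabanUV.Beta.GAN24.WSlotCauchyOfShapes (locStencil₂_le_mono mul_pow_le_mul_pow)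
open Summit.QuantumFields.BalabanUV.Beta.GAN24.CombTowerEndOfT2ev (exists_allScalesSeq_JsB12CombShSym_an1_of_sRows_T2ev
  d1Drift_JsB12CombShSym_an1_iff_lim_eq_of_sRows_T2ev)
open Summit.QuantumFields.BalabanUV.Beta.GAN24.CombT2DriftHalfMemberOfDivergences (exists_hT₂_hT₂d_even_comb_three_of_divergence_rows)
open Summit.QuantumFields.BalabanUV.Beta.GAN24.CombSlavedDivRowsAtRecord (exists_slavedDivRows_evenMember_comb_three_of_tableLaws)
open Summit.QuantumFields.BalabanUV.Beta.GAN24.CombT2RecSourceRows (exists_sourceRows_comb_three_an1_of_scombOf_rows)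
open Summit.QuantumFields.BalabanUV.Beta.GAN24.CombLegRowsOfCombWindows (exists_legRows_halfMember_comb_three_of_combWindows)
-- §4 (the contact-letter currency of road-P2 g56's M.104 ∕ M.105)
open AffineAveraging (Site)
open AveragingContoursRooted (ctr ctrOff ctrOff_mem_box)
open B4ContourShift (supNorm)
open StepJetData (wilsonA)
open BalabanCompositeJets (respStep)
open Summit.QuantumFields.BalabanUV.Beta.SymCorrectorKernel (psiKS)
open Summit.QuantumFields.BalabanUV.Beta.SymmetrisedStepJets (SymTables)
open Summit.QuantumFields.BalabanUV.Beta.SymAveragingHessianCounts (symHessFFAt symVhSAt)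
open Summit.QuantumFields.BalabanUV.Beta.GAN24.CombesThomas (KStepUnit SupBound)
open Summit.QuantumFields.BalabanUV.Beta.GAN24.Push4 (legComp IsFF)
open Summit.QuantumFields.BalabanUV.Beta.GAN24.Push4Iter (legChain)
open Summit.QuantumFields.BalabanUV.Beta.GAN24.Push3 (push₃)
open Summit.QuantumFields.BalabanUV.Beta.GAN24.AffineUnroll (transport)
open Summit.QuantumFields.BalabanUV.Beta.GAN24.SrecLinearPartEq (colM rowMM reslot)
open Summit.QuantumFields.BalabanUV.Beta.GAN24.RespStepBmDecompExact (respStepBmSeq)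
open Summit.QuantumFields.BalabanUV.Beta.GAN24.CombBornSector (combFreshAt combUnitStepMap)
open Summit.QuantumFields.BalabanUV.Beta.GAN24.CombWilsonSectorRate (exists_hS0_hSdev_combWilson_of_contact_ENDs)
open Summit.QuantumFields.BalabanUV.Beta.GAN24.CombSRowsOfContactLetters (exists_hB_combBorn_of_contact exists_hBd_combBorn_of_contactPairs)
open Summit.QuantumFields.BalabanUV.Beta.GAN24.CombSRowsOfSectors (exists_hS_hSall_ScombOf_of_sectors_common)
open Summit.QuantumFields.BalabanUV.Beta.GAN24.CombTowerEndOfLetterRows (exists_allScalesSeq_JsB12CombShSym_an1_of_letterRows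
  d1Drift_JsB12CombShSym_an1_iff_lim_eq_of_letterRows exists_allScalesSeq_JsB12CombShSym_an1_of_contactLetters_letterRows)
open Summit.QuantumFields.BalabanUV.Beta.GAN24.CombTableLawsAtPin (exists_tableLaws_parities_comb_three_at_pin)
open Summit.QuantumFields.BalabanUV.Beta.GAN24.CombPinLockScalar (hcH0_pin_three hcH_pin_three hq_pin_three)

namespace Summit.QuantumFields.BalabanUV.Beta.GAN24.CombTowerEndAtPin

variable {Lc : ℕ} [NeZero Lc]

/-! ## §1 The G-an2-4 END at the literal of record from the S-slot rows and the (C)^{ev} row only -/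

/-- NOT IN PRINT; OUR BOOKKEEPING.  **THE G-an2-4 END AT ROW D1's LITERAL OF RECORD (III′) FROM (b) THE S-SLOT ROWS OF `ScombOf` AND (d) THE (C)^{ev} ROW — NOTHING
ELSE** (`Lc` odd, `2 ≤ Lc`, `2 ≤ N`, the two locks): the OWNER's `exists_allScalesSeq_JsB12CombShSym_an1_of_letterRows` at `cΛt := cΛ`, `ξ := ½`, `r := ctrOff 4 Lc`,
`cH l := (stepScale 3 Lc l · Lc^{3+1})⁻¹` with (a) the table laws + parities := MY `exists_tableLaws_parities_comb_three_at_pin` (at `cE := Lc⁴`, `cVH := −Lc⁸∕2`,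
`cE₂ := Lc⁸` by `norm_num ∕ ring ∕ rfl`) and (c) `hcH0 ∕ hcH ∕ hq := CombPinLockScalar.…_pin_three`.  Rows (b)(d) DISPLAYED; asserts NO value of any table; NEVER
«G-an2-4 closed» as (CONV-C). -/
theorem exists_allScalesSeq_JsB12CombShSym_an1_of_sRows_at_pin (hLc : Odd Lc) (hLc2 : 2 ≤ Lc) {N : ℕ} (hN : 2 ≤ N) {cΛ cB : ℝ} (hΛ : cΛ * (Lc : ℝ) ^ 4 = 2) (hcB : cB = -((Lc : ℝ) ^ 12 / 4))
    {Cs cS θS δS : ℝ}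
    (hS : ∀ j, LocStencil (unitS (sfStep Lc j) (smStep 3 Lc j) (ScombOf (symTablesAn1S2 3 Lc cΛ) ((Lc : ℝ) ^ 4) (-((Lc : ℝ) ^ 8 / 2)) cΛ j)) Cs δS)
    (hSall : ∀ k j, LocStencil (unitS (sfStep Lc (k + j)) (smStep 3 Lc (k + j)) (ScombOf (symTablesAn1S2 3 Lc cΛ) ((Lc : ℝ) ^ 4) (-((Lc : ℝ) ^ 8 / 2)) cΛ (k + j)) -
      unitS (sfStep Lc k) (smStep 3 Lc k) (ScombOf (symTablesAn1S2 3 Lc cΛ) ((Lc : ℝ) ^ 4) (-((Lc : ℝ) ^ 8 / 2)) cΛ k)) (cS * θS ^ k) δS)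
    (hδS : 0 < δS) (hθS0 : 0 ≤ θS) (hθS1 : θS < 1)
    (hC : ∀ l : ℕ, (∀ κ κ' κ₁ κ₂, zmode Lc ((((1 : ℝ) / 2) • ((fun κ u κ' u' => (((Lc : ℝ) ^ 8) * (Lc : ℝ) ^ (2 * (3 + 1))) • mmRead Lc (K3OfK (unitK (sfStep Lc l) (smStep 3 Lc l) (GcombSh (d := 3) Lc l)) Lc (unitS (sfStep Lc l) (smStep 3 Lc l) (SpureCombOf (symTablesAn1S2 3 Lc cΛ) ((Lc : ℝ) ^ 4) (-((Lc : ℝ) ^ 8 / 2)) cΛ l)) (unitM (sfStep Lc l) (smStep 3 Lc l) ((symTablesAn1S2 3 Lc cΛ).M l)) (W2SymOfK (unitK (sfStep Lc l) (smStep 3 Lc l) (GcombSh (d := 3) Lc l)) Lc (unitS (sfStep Lc l) (smStep 3 Lc l) (SpureCombOf (symTablesAn1S2 3 Lc cΛ) ((Lc : ℝ) ^ 4) (-((Lc : ℝ) ^ 8 / 2)) cΛ l)) (unitM (sfStep Lc l) (smStep 3 Lc l) ((symTablesAn1S2 3 Lc cΛ).M l)) 0 (unitM₂ (sfStep Lc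 l) (smStep 3 Lc l) (M2Of 3 Lc (symTablesAn1S2 3 Lc cΛ).mixFF l))) κ u κ' u') + cB • (symTablesAn1S2 3 Lc cΛ).vh₂S κ u κ' u') + fun κ u κ' u' => sgnK (trK ((((Lc : ℝ) ^ 8) * (Lc : ℝ) ^ (2 * (3 + 1))) • mmRead Lc (K3OfK (unitK (sfStep Lc l) (smStep 3 Lc l) (GcombSh (d := 3) Lc l)) Lc (unitS (sfStep Lc l) (smStep 3 Lc l) (SpureCombOf (symTablesAn1S2 3 Lc cΛ) ((Lc : ℝ) ^ 4) (-((Lc : ℝ) ^ 8 / 2)) cΛ l)) (unitM (sfStep Lc l) (smStep 3 Lc l) ((symTablesAn1S2 3 Lc cΛ).M l)) (W2SymOfK (unitK (sfStep Lc l) (smStep 3 Lc l) (GcombSh (d := 3) Lc l)) Lc (unitS (sfStep Lc l) (smStep 3 Lc l) (SpureCombOf (symTablesAn1S2 3 Lc cΛ) ((Lc : ℝ) ^ 4) (-((Lc : ℝ) ^ 8 / 2)) cΛ l)) (unitM (sfStep Lc l) (smStep 3 Lc l) ((symTablesAn1S2 3 Lc cΛ).M l)) 0 (unitM₂ (sfStep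 Lc l) (smStep 3 Lc l) (M2Of 3 Lc (symTablesAn1S2 3 Lc cΛ).mixFF l))) κ u κ' u') + cB • (symTablesAn1S2 3 Lc cΛ).vh₂S κ u κ' u')))) +
          (lin4 (((Lc : ℝ) ^ 8) * (Lc : ℝ) ^ (2 * (3 + 1))) (unitK (sfStep Lc l) (smStep 3 Lc l) (GcombSh (d := 3) Lc l)) Lc (((1 : ℝ) / 2) • (unitS₂ (sfStep Lc l) (smStep 3 Lc l) (T2RecOf 3 Lc (GcombSh Lc) (SpureCombOf (symTablesAn1S2 3 Lc cΛ) ((Lc : ℝ) ^ 4) (-((Lc : ℝ) ^ 8 / 2)) cΛ) (symTablesAn1S2 3 Lc cΛ).M ((Lc : ℝ) ^ 8) cB ((8 * (N : ℝ) ^ 2)⁻¹ • wsym22 N) (symTablesAn1S2 3 Lc cΛ).vh₂S (symTablesAn1S2 3 Lc cΛ).mixFF l) + fun κ u κ' u' => sgnK (trK ((unitS₂ (sfStep Lc l) (smStep 3 Lc l) (T2RecOf 3 Lc (GcombSh Lc) (SpureCombOf (symTablesAn1S2 3 Lc cΛ) ((Lc : ℝ) ^ 4) (-((Lc : ℝ)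 ^ 8 / 2)) cΛ) (symTablesAn1S2 3 Lc cΛ).M ((Lc : ℝ) ^ 8) cB ((8 * (N : ℝ) ^ 2)⁻¹ • wsym22 N) (symTablesAn1S2 3 Lc cΛ).vh₂S (symTablesAn1S2 3 Lc cΛ).mixFF l)) κ u κ' u'))))
          - lin4 (((Lc : ℝ) ^ 8) * (Lc : ℝ) ^ (2 * (3 + 1))) (unitK (sfStep Lc l) (smStep 3 Lc l) (KInvStep (d := 3) Lc l)) Lc (((1 : ℝ) / 2) • (unitS₂ (sfStep Lc l) (smStep 3 Lc l) (T2RecOf 3 Lc (GcombSh Lc) (SpureCombOf (symTablesAn1S2 3 Lc cΛ) ((Lc : ℝ) ^ 4) (-((Lc : ℝ) ^ 8 / 2)) cΛ) (symTablesAn1S2 3 Lc cΛ).M ((Lc : ℝ) ^ 8) cB ((8 * (N : ℝ) ^ 2)⁻¹ • wsym22 N) (symTablesAn1S2 3 Lc cΛ).vh₂S (symTablesAn1S2 3 Lc cΛ).mixFF l) + fun κ u κ' u' => sgnK (trK ((unitS₂ (sfStep Lc l) (smStep 3 Lc l) (T2RecOf 3 Lc (GcombSh Lc) (SpureCombOf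 (symTablesAn1S2 3 Lc cΛ) ((Lc : ℝ) ^ 4) (-((Lc : ℝ) ^ 8 / 2)) cΛ) (symTablesAn1S2 3 Lc cΛ).M ((Lc : ℝ) ^ 8) cB ((8 * (N : ℝ) ^ 2)⁻¹ • wsym22 N) (symTablesAn1S2 3 Lc cΛ).vh₂S (symTablesAn1S2 3 Lc cΛ).mixFF l)) κ u κ' u')))))) κ κ' (Sum.inl κ₁) (Sum.inl κ₂)
        + zmode Lc ((((1 : ℝ) / 2) • ((fun κ u κ' u' => (((Lc : ℝ) ^ 8) * (Lc : ℝ) ^ (2 * (3 + 1))) • mmRead Lc (K3OfK (unitK (sfStep Lc l) (smStep 3 Lc l) (GcombSh (d := 3) Lc l)) Lc (unitS (sfStep Lc l) (smStep 3 Lc l) (SpureCombOf (symTablesAn1S2 3 Lc cΛ) ((Lc : ℝ) ^ 4) (-((Lc : ℝ) ^ 8 / 2)) cΛ l)) (unitM (sfStep Lc l) (smStep 3 Lc l) ((symTablesAn1S2 3 Lc cΛ).M l)) (W2SymOfK (unitK (sfStep Lc l) (smStep 3 Lc l) (GcombSh (d := 3) Lc l)) Lc (unitS (sfStep Lc l)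 (smStep 3 Lc l) (SpureCombOf (symTablesAn1S2 3 Lc cΛ) ((Lc : ℝ) ^ 4) (-((Lc : ℝ) ^ 8 / 2)) cΛ l)) (unitM (sfStep Lc l) (smStep 3 Lc l) ((symTablesAn1S2 3 Lc cΛ).M l)) 0 (unitM₂ (sfStep Lc l) (smStep 3 Lc l) (M2Of 3 Lc (symTablesAn1S2 3 Lc cΛ).mixFF l))) κ u κ' u') + cB • (symTablesAn1S2 3 Lc cΛ).vh₂S κ u κ' u') + fun κ u κ' u' => sgnK (trK ((((Lc : ℝ) ^ 8) * (Lc : ℝ) ^ (2 * (3 + 1))) • mmRead Lc (K3OfK (unitK (sfStep Lc l) (smStep 3 Lc l) (GcombSh (d := 3) Lc l)) Lc (unitS (sfStep Lc l) (smStep 3 Lc l) (SpureCombOf (symTablesAn1S2 3 Lc cΛ) ((Lc : ℝ) ^ 4) (-((Lc : ℝ) ^ 8 / 2)) cΛ l)) (unitM (sfStep Lc l) (smStep 3 Lc l) ((symTablesAn1S2 3 Lc cΛ).M l)) (W2SymOfK (unitK (sfStep Lc l) (smStep 3 Lc l) (GcombSh (d := 3) Lc l)) Lc (unitS (sfStep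 Lc l) (smStep 3 Lc l) (SpureCombOf (symTablesAn1S2 3 Lc cΛ) ((Lc : ℝ) ^ 4) (-((Lc : ℝ) ^ 8 / 2)) cΛ l)) (unitM (sfStep Lc l) (smStep 3 Lc l) ((symTablesAn1S2 3 Lc cΛ).M l)) 0 (unitM₂ (sfStep Lc l) (smStep 3 Lc l) (M2Of 3 Lc (symTablesAn1S2 3 Lc cΛ).mixFF l))) κ u κ' u') + cB • (symTablesAn1S2 3 Lc cΛ).vh₂S κ u κ' u')))) +
          (lin4 (((Lc : ℝ) ^ 8) * (Lc : ℝ) ^ (2 * (3 + 1))) (unitK (sfStep Lc l) (smStep 3 Lc l) (GcombSh (d := 3) Lc l)) Lc (((1 : ℝ) / 2) • (unitS₂ (sfStep Lc l) (smStep 3 Lc l) (T2RecOf 3 Lc (GcombSh Lc) (SpureCombOf (symTablesAn1S2 3 Lc cΛ) ((Lc : ℝ) ^ 4) (-((Lc : ℝ) ^ 8 / 2)) cΛ) (symTablesAn1S2 3 Lc cΛ).M ((Lc : ℝ) ^ 8) cB ((8 * (N : ℝ) ^ 2)⁻¹ • wsym22 N) (symTablesAn1S2 3 Lc cΛ).vh₂S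 (symTablesAn1S2 3 Lc cΛ).mixFF l) + fun κ u κ' u' => sgnK (trK ((unitS₂ (sfStep Lc l) (smStep 3 Lc l) (T2RecOf 3 Lc (GcombSh Lc) (SpureCombOf (symTablesAn1S2 3 Lc cΛ) ((Lc : ℝ) ^ 4) (-((Lc : ℝ) ^ 8 / 2)) cΛ) (symTablesAn1S2 3 Lc cΛ).M ((Lc : ℝ) ^ 8) cB ((8 * (N : ℝ) ^ 2)⁻¹ • wsym22 N) (symTablesAn1S2 3 Lc cΛ).vh₂S (symTablesAn1S2 3 Lc cΛ).mixFF l)) κ u κ' u'))))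
          - lin4 (((Lc : ℝ) ^ 8) * (Lc : ℝ) ^ (2 * (3 + 1))) (unitK (sfStep Lc l) (smStep 3 Lc l) (KInvStep (d := 3) Lc l)) Lc (((1 : ℝ) / 2) • (unitS₂ (sfStep Lc l) (smStep 3 Lc l) (T2RecOf 3 Lc (GcombSh Lc) (SpureCombOf (symTablesAn1S2 3 Lc cΛ) ((Lc : ℝ) ^ 4) (-((Lc : ℝ) ^ 8 / 2)) cΛ) (symTablesAn1S2 3 Lc cΛ).M ((Lc : ℝ) ^ 8) cB ((8 * (N : ℝ) ^ 2)⁻¹ • wsym22 N) (symTablesAn1S2 3 Lc cΛ).vh₂S (symTablesAn1S2 3 Lc cΛ).mixFF l) + fun κ u κ' u' => sgnK (trK ((unitS₂ (sfStep Lc l) (smStep 3 Lc l) (T2RecOf 3 Lc (GcombSh Lc) (SpureCombOf (symTablesAn1S2 3 Lc cΛ) ((Lc : ℝ) ^ 4) (-((Lc : ℝ) ^ 8 / 2)) cΛ) (symTablesAn1S2 3 Lc cΛ).M ((Lc : ℝ) ^ 8) cB ((8 * (N : ℝ) ^ 2)⁻¹ • wsym22 N) (symTablesAn1S2 3 Lc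 cΛ).vh₂S (symTablesAn1S2 3 Lc cΛ).mixFF l)) κ u κ' u')))))) κ' κ (Sum.inl κ₁) (Sum.inl κ₂) = 0))
    (μ ν : Fin 4) :
    ∃ κ θ : ℝ, 0 ≤ θ ∧ θ < 1 ∧ AllScalesSeq (fun j => B12Beta.secondMoment (TbalOf Lc (JsB12CombShSym hLc N (symTablesAn1S2 3 Lc cΛ) cΛ cB) j) μ ν) κ θ := by
  obtain ⟨R, R'', hTL, hTL'', hCm, hR, hR''⟩ := exists_tableLaws_parities_comb_three_at_pin (Lc := Lc) hLc hN hΛ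
    (cE := (Lc : ℝ) ^ 4) (cVH := -((Lc : ℝ) ^ 8 / 2)) (cE₂ := (Lc : ℝ) ^ 8) (by norm_num) (by ring) rfl hcB
    (Tc := (8 * (N : ℝ) ^ 2)⁻¹ • wsym22 N) rfl
  exact exists_allScalesSeq_JsB12CombShSym_an1_of_letterRows hLc hLc2 N cΛ cΛ cB (1 / 2 : ℝ) (ctrOff_mem_box (le_trans one_le_two hLc2))
    hcH0_pin_three hcH_pin_three hq_pin_three hTL hTL'' hCm hR hR'' hS hSall hδS hθS0 hθS1 hC μ ν

/-! ## §2 Row D1's reading of the wall under the same two rows -/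

/-- NOT IN PRINT; OUR BOOKKEEPING.  **ROW D1's READING `↔ lim β = stepBal` AT THE LITERAL OF RECORD FROM (b) THE S-SLOT ROWS AND (d) THE (C)^{ev} ROW** (the OWNER's
`d1Drift_JsB12CombShSym_an1_iff_lim_eq_of_letterRows` with (a)(c) discharged as in §1; the VALUE `lim β = stepBal Nc Lc` is row D1's and is NOT proved — only its
equivalence with the wall term, given the rows). -/
theorem d1Drift_JsB12CombShSym_an1_iff_lim_eq_of_sRows_at_pin (hLc : Odd Lc) (hLc2 : 2 ≤ Lc) {N : ℕ} (hN : 2 ≤ N) {cΛ cB : ℝ} (hΛ : cΛ * (Lc : ℝ) ^ 4 = 2) (hcB : cB = -((Lc : ℝ) ^ 12 / 4))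
    {Cs cS θS δS : ℝ}
    (hS : ∀ j, LocStencil (unitS (sfStep Lc j) (smStep 3 Lc j) (ScombOf (symTablesAn1S2 3 Lc cΛ) ((Lc : ℝ) ^ 4) (-((Lc : ℝ) ^ 8 / 2)) cΛ j)) Cs δS)
    (hSall : ∀ k j, LocStencil (unitS (sfStep Lc (k + j)) (smStep 3 Lc (k + j)) (ScombOf (symTablesAn1S2 3 Lc cΛ) ((Lc : ℝ) ^ 4) (-((Lc : ℝ) ^ 8 / 2)) cΛ (k + j)) -
      unitS (sfStep Lc k) (smStep 3 Lc k) (ScombOf (symTablesAn1S2 3 Lc cΛ) ((Lc : ℝ) ^ 4) (-((Lc : ℝ) ^ 8 / 2)) cΛ k)) (cS * θS ^ k) δS)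
    (hδS : 0 < δS) (hθS0 : 0 ≤ θS) (hθS1 : θS < 1)
    (hC : ∀ l : ℕ, (∀ κ κ' κ₁ κ₂, zmode Lc ((((1 : ℝ) / 2) • ((fun κ u κ' u' => (((Lc : ℝ) ^ 8) * (Lc : ℝ) ^ (2 * (3 + 1))) • mmRead Lc (K3OfK (unitK (sfStep Lc l) (smStep 3 Lc l) (GcombSh (d := 3) Lc l)) Lc (unitS (sfStep Lc l) (smStep 3 Lc l) (SpureCombOf (symTablesAn1S2 3 Lc cΛ) ((Lc : ℝ) ^ 4) (-((Lc : ℝ) ^ 8 / 2)) cΛ l)) (unitM (sfStep Lc l) (smStep 3 Lc l) ((symTablesAn1S2 3 Lc cΛ).M l)) (W2SymOfK (unitK (sfStep Lc l) (smStep 3 Lc l) (GcombSh (d := 3) Lc l)) Lc (unitS (sfStep Lc l) (smStep 3 Lc l) (SpureCombOf (symTablesAn1S2 3 Lc cΛ) ((Lc : ℝ) ^ 4) (-((Lc : ℝ) ^ 8 / 2)) cΛ l)) (unitM (sfStep Lc l) (smStep 3 Lc l) ((symTablesAn1S2 3 Lc cΛ).M l)) 0 (unitM₂ (sfStep Lc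 l) (smStep 3 Lc l) (M2Of 3 Lc (symTablesAn1S2 3 Lc cΛ).mixFF l))) κ u κ' u') + cB • (symTablesAn1S2 3 Lc cΛ).vh₂S κ u κ' u') + fun κ u κ' u' => sgnK (trK ((((Lc : ℝ) ^ 8) * (Lc : ℝ) ^ (2 * (3 + 1))) • mmRead Lc (K3OfK (unitK (sfStep Lc l) (smStep 3 Lc l) (GcombSh (d := 3) Lc l)) Lc (unitS (sfStep Lc l) (smStep 3 Lc l) (SpureCombOf (symTablesAn1S2 3 Lc cΛ) ((Lc : ℝ) ^ 4) (-((Lc : ℝ) ^ 8 / 2)) cΛ l)) (unitM (sfStep Lc l) (smStep 3 Lc l) ((symTablesAn1S2 3 Lc cΛ).M l)) (W2SymOfK (unitK (sfStep Lc l) (smStep 3 Lc l) (GcombSh (d := 3) Lc l)) Lc (unitS (sfStep Lc l) (smStep 3 Lc l) (SpureCombOf (symTablesAn1S2 3 Lc cΛ) ((Lc : ℝ) ^ 4) (-((Lc : ℝ) ^ 8 / 2)) cΛ l)) (unitM (sfStep Lc l) (smStep 3 Lc l) ((symTablesAn1S2 3 Lc cΛ).M l)) 0 (unitM₂ (sfStep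 Lc l) (smStep 3 Lc l) (M2Of 3 Lc (symTablesAn1S2 3 Lc cΛ).mixFF l))) κ u κ' u') + cB • (symTablesAn1S2 3 Lc cΛ).vh₂S κ u κ' u')))) +
          (lin4 (((Lc : ℝ) ^ 8) * (Lc : ℝ) ^ (2 * (3 + 1))) (unitK (sfStep Lc l) (smStep 3 Lc l) (GcombSh (d := 3) Lc l)) Lc (((1 : ℝ) / 2) • (unitS₂ (sfStep Lc l) (smStep 3 Lc l) (T2RecOf 3 Lc (GcombSh Lc) (SpureCombOf (symTablesAn1S2 3 Lc cΛ) ((Lc : ℝ) ^ 4) (-((Lc : ℝ) ^ 8 / 2)) cΛ) (symTablesAn1S2 3 Lc cΛ).M ((Lc : ℝ) ^ 8) cB ((8 * (N : ℝ) ^ 2)⁻¹ • wsym22 N) (symTablesAn1S2 3 Lc cΛ).vh₂S (symTablesAn1S2 3 Lc cΛ).mixFF l) + fun κ u κ' u' => sgnK (trK ((unitS₂ (sfStep Lc l) (smStep 3 Lc l) (T2RecOf 3 Lc (GcombSh Lc) (SpureCombOf (symTablesAn1S2 3 Lc cΛ) ((Lc : ℝ) ^ 4) (-((Lc : ℝ)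 ^ 8 / 2)) cΛ) (symTablesAn1S2 3 Lc cΛ).M ((Lc : ℝ) ^ 8) cB ((8 * (N : ℝ) ^ 2)⁻¹ • wsym22 N) (symTablesAn1S2 3 Lc cΛ).vh₂S (symTablesAn1S2 3 Lc cΛ).mixFF l)) κ u κ' u'))))
          - lin4 (((Lc : ℝ) ^ 8) * (Lc : ℝ) ^ (2 * (3 + 1))) (unitK (sfStep Lc l) (smStep 3 Lc l) (KInvStep (d := 3) Lc l)) Lc (((1 : ℝ) / 2) • (unitS₂ (sfStep Lc l) (smStep 3 Lc l) (T2RecOf 3 Lc (GcombSh Lc) (SpureCombOf (symTablesAn1S2 3 Lc cΛ) ((Lc : ℝ) ^ 4) (-((Lc : ℝ) ^ 8 / 2)) cΛ) (symTablesAn1S2 3 Lc cΛ).M ((Lc : ℝ) ^ 8) cB ((8 * (N : ℝ) ^ 2)⁻¹ • wsym22 N) (symTablesAn1S2 3 Lc cΛ).vh₂S (symTablesAn1S2 3 Lc cΛ).mixFF l) + fun κ u κ' u' => sgnK (trK ((unitS₂ (sfStep Lc l) (smStep 3 Lc l) (T2RecOf 3 Lc (GcombSh Lc) (SpureCombOf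 (symTablesAn1S2 3 Lc cΛ) ((Lc : ℝ) ^ 4) (-((Lc : ℝ) ^ 8 / 2)) cΛ) (symTablesAn1S2 3 Lc cΛ).M ((Lc : ℝ) ^ 8) cB ((8 * (N : ℝ) ^ 2)⁻¹ • wsym22 N) (symTablesAn1S2 3 Lc cΛ).vh₂S (symTablesAn1S2 3 Lc cΛ).mixFF l)) κ u κ' u')))))) κ κ' (Sum.inl κ₁) (Sum.inl κ₂)
        + zmode Lc ((((1 : ℝ) / 2) • ((fun κ u κ' u' => (((Lc : ℝ) ^ 8) * (Lc : ℝ) ^ (2 * (3 + 1))) • mmRead Lc (K3OfK (unitK (sfStep Lc l) (smStep 3 Lc l) (GcombSh (d := 3) Lc l)) Lc (unitS (sfStep Lc l) (smStep 3 Lc l) (SpureCombOf (symTablesAn1S2 3 Lc cΛ) ((Lc : ℝ) ^ 4) (-((Lc : ℝ) ^ 8 / 2)) cΛ l)) (unitM (sfStep Lc l) (smStep 3 Lc l) ((symTablesAn1S2 3 Lc cΛ).M l)) (W2SymOfK (unitK (sfStep Lc l) (smStep 3 Lc l) (GcombSh (d := 3) Lc l)) Lc (unitS (sfStep Lc l)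 (smStep 3 Lc l) (SpureCombOf (symTablesAn1S2 3 Lc cΛ) ((Lc : ℝ) ^ 4) (-((Lc : ℝ) ^ 8 / 2)) cΛ l)) (unitM (sfStep Lc l) (smStep 3 Lc l) ((symTablesAn1S2 3 Lc cΛ).M l)) 0 (unitM₂ (sfStep Lc l) (smStep 3 Lc l) (M2Of 3 Lc (symTablesAn1S2 3 Lc cΛ).mixFF l))) κ u κ' u') + cB • (symTablesAn1S2 3 Lc cΛ).vh₂S κ u κ' u') + fun κ u κ' u' => sgnK (trK ((((Lc : ℝ) ^ 8) * (Lc : ℝ) ^ (2 * (3 + 1))) • mmRead Lc (K3OfK (unitK (sfStep Lc l) (smStep 3 Lc l) (GcombSh (d := 3) Lc l)) Lc (unitS (sfStep Lc l) (smStep 3 Lc l) (SpureCombOf (symTablesAn1S2 3 Lc cΛ) ((Lc : ℝ) ^ 4) (-((Lc : ℝ) ^ 8 / 2)) cΛ l)) (unitM (sfStep Lc l) (smStep 3 Lc l) ((symTablesAn1S2 3 Lc cΛ).M l)) (W2SymOfK (unitK (sfStep Lc l) (smStep 3 Lc l) (GcombSh (d := 3) Lc l)) Lc (unitS (sfStep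 Lc l) (smStep 3 Lc l) (SpureCombOf (symTablesAn1S2 3 Lc cΛ) ((Lc : ℝ) ^ 4) (-((Lc : ℝ) ^ 8 / 2)) cΛ l)) (unitM (sfStep Lc l) (smStep 3 Lc l) ((symTablesAn1S2 3 Lc cΛ).M l)) 0 (unitM₂ (sfStep Lc l) (smStep 3 Lc l) (M2Of 3 Lc (symTablesAn1S2 3 Lc cΛ).mixFF l))) κ u κ' u') + cB • (symTablesAn1S2 3 Lc cΛ).vh₂S κ u κ' u')))) +
          (lin4 (((Lc : ℝ) ^ 8) * (Lc : ℝ) ^ (2 * (3 + 1))) (unitK (sfStep Lc l) (smStep 3 Lc l) (GcombSh (d := 3) Lc l)) Lc (((1 : ℝ) / 2) • (unitS₂ (sfStep Lc l) (smStep 3 Lc l) (T2RecOf 3 Lc (GcombSh Lc) (SpureCombOf (symTablesAn1S2 3 Lc cΛ) ((Lc : ℝ) ^ 4) (-((Lc : ℝ) ^ 8 / 2)) cΛ) (symTablesAn1S2 3 Lc cΛ).M ((Lc : ℝ) ^ 8) cB ((8 * (N : ℝ) ^ 2)⁻¹ • wsym22 N) (symTablesAn1S2 3 Lc cΛ).vh₂S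 (symTablesAn1S2 3 Lc cΛ).mixFF l) + fun κ u κ' u' => sgnK (trK ((unitS₂ (sfStep Lc l) (smStep 3 Lc l) (T2RecOf 3 Lc (GcombSh Lc) (SpureCombOf (symTablesAn1S2 3 Lc cΛ) ((Lc : ℝ) ^ 4) (-((Lc : ℝ) ^ 8 / 2)) cΛ) (symTablesAn1S2 3 Lc cΛ).M ((Lc : ℝ) ^ 8) cB ((8 * (N : ℝ) ^ 2)⁻¹ • wsym22 N) (symTablesAn1S2 3 Lc cΛ).vh₂S (symTablesAn1S2 3 Lc cΛ).mixFF l)) κ u κ' u'))))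
          - lin4 (((Lc : ℝ) ^ 8) * (Lc : ℝ) ^ (2 * (3 + 1))) (unitK (sfStep Lc l) (smStep 3 Lc l) (KInvStep (d := 3) Lc l)) Lc (((1 : ℝ) / 2) • (unitS₂ (sfStep Lc l) (smStep 3 Lc l) (T2RecOf 3 Lc (GcombSh Lc) (SpureCombOf (symTablesAn1S2 3 Lc cΛ) ((Lc : ℝ) ^ 4) (-((Lc : ℝ) ^ 8 / 2)) cΛ) (symTablesAn1S2 3 Lc cΛ).M ((Lc : ℝ) ^ 8) cB ((8 * (N : ℝ) ^ 2)⁻¹ • wsym22 N) (symTablesAn1S2 3 Lc cΛ).vh₂S (symTablesAn1S2 3 Lc cΛ).mixFF l) + fun κ u κ' u' => sgnK (trK ((unitS₂ (sfStep Lc l) (smStep 3 Lc l) (T2RecOf 3 Lc (GcombSh Lc) (SpureCombOf (symTablesAn1S2 3 Lc cΛ) ((Lc : ℝ) ^ 4) (-((Lc : ℝ) ^ 8 / 2)) cΛ) (symTablesAn1S2 3 Lc cΛ).M ((Lc : ℝ) ^ 8) cB ((8 * (N : ℝ) ^ 2)⁻¹ • wsym22 N) (symTablesAn1S2 3 Lc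 cΛ).vh₂S (symTablesAn1S2 3 Lc cΛ).mixFF l)) κ u κ' u')))))) κ' κ (Sum.inl κ₁) (Sum.inl κ₂) = 0))
    (μ ν : Fin 4) (Nc : ℝ) :
    D1Drift Lc (JsB12CombShSym hLc N (symTablesAn1S2 3 Lc cΛ) cΛ cB) Nc μ ν ↔
      RateCertificate.CauchyRate.lim (fun j => B12Beta.secondMoment (TbalOf Lc (JsB12CombShSym hLc N (symTablesAn1S2 3 Lc cΛ) cΛ cB) j) μ ν) =
        B12Normalization.stepBal Nc Lc := by
  obtain ⟨R, R'', hTL, hTL'', hCm, hR, hR''⟩ := exists_tableLaws_parities_comb_three_at_pin (Lc := Lc) hLc hN hΛ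
    (cE := (Lc : ℝ) ^ 4) (cVH := -((Lc : ℝ) ^ 8 / 2)) (cE₂ := (Lc : ℝ) ^ 8) (by norm_num) (by ring) rfl hcB
    (Tc := (8 * (N : ℝ) ^ 2)⁻¹ • wsym22 N) rfl
  exact d1Drift_JsB12CombShSym_an1_iff_lim_eq_of_letterRows hLc hLc2 N cΛ cΛ cB (1 / 2 : ℝ) (ctrOff_mem_box (le_trans one_le_two hLc2))
    hcH0_pin_three hcH_pin_three hq_pin_three hTL hTL'' hCm hR hR'' hS hSall hδS hθS0 hθS1 hC μ ν Nc

/-! ## §3 The same END with the S-slot rows read from road-P2's six contact letters -/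

/-- NOT IN PRINT; OUR BOOKKEEPING.  **THE G-an2-4 END AT ROW D1's LITERAL OF RECORD FROM road-P2 g56's SIX S-SLOT CONTACT LETTERS AND THE (C)^{ev} ROW — NOTHING ELSE**
(the OWNER's §4 `exists_allScalesSeq_JsB12CombShSym_an1_of_contactLetters_letterRows` with (a)(c) discharged as in §1; the six letters `hCT hCTd hCg hPc hCv hPcV` are its
binders VERBATIM at `cΛt := cΛ`; default heartbeats).  Letters and (d) DISPLAYED; S-slot 0∕2 as VALUES; NEVER «G-an2-4 closed» as (CONV-C). -/
theorem exists_allScalesSeq_JsB12CombShSym_an1_of_contactLetters_at_pin (hLc : Odd Lc) (hLc2 : 2 ≤ Lc) {N : ℕ} (hN : 2 ≤ N) {cΛ cB : ℝ} (hΛ : cΛ * (Lc : ℝ) ^ 4 = 2) (hcB : cB = -((Lc : ℝ) ^ 12 / 4)) {p q : ℕ}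
    (hCT : ∃ κ' K : ℝ, 0 < κ' ∧ 0 ≤ K ∧
      ∀ (k : ℕ) (κ₁ : Fin (3 + 1)) (u' x' z' : Site (3 + 1)) (α β : Fin (3 + 1)),
        |push₃
            (legChain (fun j => legComp (fun α x κ u => psiKS (ctrOff (3 + 1) Lc) Lc u x (Sum.inl κ) (Sum.inl α)) (respStepBmSeq (d := 3) (ctr (3 + 1) Lc) Lc j)) 0 k)
            (legChain (fun j => legComp (fun α x κ u => psiKS (ctrOff (3 + 1) Lc) Lc u x (Sum.inl κ) (Sum.inl α)) (respStepBmSeq (d := 3) (ctr (3 + 1) Lc) Lc j)) 0 k)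
            (legChain (fun j => legComp (fun α x κ u => psiKS (ctrOff (3 + 1) Lc) Lc u x (Sum.inl κ) (Sum.inl α)) (respStepBmSeq (d := 3) (ctr (3 + 1) Lc) Lc j)) 0 k)
            (wilsonA 3) κ₁ u' x' z' (Sum.inl α) (Sum.inl β)
          - push₃ (respStep (d := 3) 1 (Lc ^ (k + 1))) (respStep (d := 3) 1 (Lc ^ (k + 1))) (respStep (d := 3) 1 (Lc ^ (k + 1)))
                (wilsonA 3) κ₁ u' x' z' (Sum.inl α) (Sum.inl β)|
          ≤ K * ((Lc : ℝ) ^ (12 * (k + 1)))⁻¹ * Real.exp (-(κ' * (supNorm (x' - u') + supNorm (z' - u')))))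
    (hCTd : ∃ K ϑ : ℝ, 0 ≤ K ∧ 0 ≤ ϑ ∧ ϑ < 1 ∧
      ∀ (k : ℕ) (κ₁ : Fin (3 + 1)) (u' x' z' : Site (3 + 1)) (α β : Fin (3 + 1)),
        |(Lc : ℝ) ^ (12 * (k + 2)) *
            (push₃
            (legChain (fun j => legComp (fun α x κ u => psiKS (ctrOff (3 + 1) Lc) Lc u x (Sum.inl κ) (Sum.inl α)) (respStepBmSeq (d := 3) (ctr (3 + 1) Lc) Lc j)) 0 (k + 1))
            (legChain (fun j => legComp (fun α x κ u => psiKS (ctrOff (3 + 1) Lc) Lc u x (Sum.inl κ) (Sum.inl α)) (respStepBmSeq (d := 3) (ctr (3 + 1) Lc) Lc j)) 0 (k + 1))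
            (legChain (fun j => legComp (fun α x κ u => psiKS (ctrOff (3 + 1) Lc) Lc u x (Sum.inl κ) (Sum.inl α)) (respStepBmSeq (d := 3) (ctr (3 + 1) Lc) Lc j)) 0 (k + 1))
            (wilsonA 3) κ₁ u' x' z' (Sum.inl α) (Sum.inl β)
              - push₃ (respStep (d := 3) 1 (Lc ^ (k + 2))) (respStep (d := 3) 1 (Lc ^ (k + 2))) (respStep (d := 3) 1 (Lc ^ (k + 2)))
                (wilsonA 3) κ₁ u' x' z' (Sum.inl α) (Sum.inl β))
          - (Lc : ℝ) ^ (12 * (k + 1)) *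
            (push₃
            (legChain (fun j => legComp (fun α x κ u => psiKS (ctrOff (3 + 1) Lc) Lc u x (Sum.inl κ) (Sum.inl α)) (respStepBmSeq (d := 3) (ctr (3 + 1) Lc) Lc j)) 0 k)
            (legChain (fun j => legComp (fun α x κ u => psiKS (ctrOff (3 + 1) Lc) Lc u x (Sum.inl κ) (Sum.inl α)) (respStepBmSeq (d := 3) (ctr (3 + 1) Lc) Lc j)) 0 k)
            (legChain (fun j => legComp (fun α x κ u => psiKS (ctrOff (3 + 1) Lc) Lc u x (Sum.inl κ) (Sum.inl α)) (respStepBmSeq (d := 3) (ctr (3 + 1) Lc) Lc j)) 0 k)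
            (wilsonA 3) κ₁ u' x' z' (Sum.inl α) (Sum.inl β)
              - push₃ (respStep (d := 3) 1 (Lc ^ (k + 1))) (respStep (d := 3) 1 (Lc ^ (k + 1))) (respStep (d := 3) 1 (Lc ^ (k + 1)))
                (wilsonA 3) κ₁ u' x' z' (Sum.inl α) (Sum.inl β))|
          ≤ K * ϑ ^ k)
    (hCg : ∃ C θ δ : ℝ, 0 ≤ C ∧ 0 ≤ θ ∧ θ < 1 ∧ 0 < δ ∧ ∀ k i : ℕ, i < k →
      LocStencil (fun κ' u' => ((Lc : ℝ) ^ 4 * (Lc : ℝ) ^ (2 * (3 + 1))) ^ (k - i) •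
        (push₃ (legChain (fun j => legComp (fun α x κ u => psiKS (ctrOff (3 + 1) Lc) Lc u x (Sum.inl κ) (Sum.inl α)) (respStepBmSeq (d := 3) (ctr (3 + 1) Lc) Lc j)) i (k - 1 - i)) (legChain (fun j => legComp (fun α x κ u => psiKS (ctrOff (3 + 1) Lc) Lc u x (Sum.inl κ) (Sum.inl α)) (respStepBmSeq (d := 3) (ctr (3 + 1) Lc) Lc j)) i (k - 1 - i))
              (legChain (fun j => legComp (fun α x κ u => psiKS (ctrOff (3 + 1) Lc) Lc u x (Sum.inl κ) (Sum.inl α)) (respStepBmSeq (d := 3) (ctr (3 + 1) Lc) Lc j)) i (k - 1 - i))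
              (unitS (sfStep Lc i) (smStep 3 Lc i) (combFreshAt (symTablesAn1S2 3 Lc cΛ) 0 cΛ i)) κ' u'
          - push₃ (respStep (d := 3) (Lc ^ i) (Lc ^ k)) (respStep (d := 3) (Lc ^ i) (Lc ^ k)) (respStep (d := 3) (Lc ^ i) (Lc ^ k))
              (unitS (sfStep Lc i) (smStep 3 Lc i) (combFreshAt (symTablesAn1S2 3 Lc cΛ) 0 cΛ i)) κ' u')) (C * ((((k - i : ℕ) : ℝ)) ^ p * θ ^ (k - i))) δ)
    (hPc : ∃ CPc Θc : ℝ, 0 ≤ CPc ∧ 0 ≤ Θc ∧ Θc < 1 ∧ ∀ k i : ℕ, 1 ≤ i → i < k → ∀ κ u,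
      SupBound
        (((fun κ' u' => ((Lc : ℝ) ^ 4 * (Lc : ℝ) ^ (2 * (3 + 1))) ^ (k - i) •
            (push₃ (legChain (fun j => legComp (fun α x κ u => psiKS (ctrOff (3 + 1) Lc) Lc u x (Sum.inl κ) (Sum.inl α)) (respStepBmSeq (d := 3) (ctr (3 + 1) Lc) Lc j)) (i + 1) (k - 1 - i)) (legChain (fun j => legComp (fun α x κ u => psiKS (ctrOff (3 + 1) Lc) Lc u x (Sum.inl κ) (Sum.inl α)) (respStepBmSeq (d := 3) (ctr (3 + 1) Lc) Lc j)) (i + 1) (k - 1 - i))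
              (legChain (fun j => legComp (fun α x κ u => psiKS (ctrOff (3 + 1) Lc) Lc u x (Sum.inl κ) (Sum.inl α)) (respStepBmSeq (d := 3) (ctr (3 + 1) Lc) Lc j)) (i + 1) (k - 1 - i))
              (unitS (sfStep Lc (i + 1)) (smStep 3 Lc (i + 1)) (combFreshAt (symTablesAn1S2 3 Lc cΛ) 0 cΛ (i + 1))) κ' u'
              - push₃ (respStep (d := 3) (Lc ^ (i + 1)) (Lc ^ (k + 1))) (respStep (d := 3) (Lc ^ (i + 1)) (Lc ^ (k + 1))) (respStep (d := 3) (Lc ^ (i + 1)) (Lc ^ (k + 1)))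
              (unitS (sfStep Lc (i + 1)) (smStep 3 Lc (i + 1)) (combFreshAt (symTablesAn1S2 3 Lc cΛ) 0 cΛ (i + 1))) κ' u'))
          - fun κ' u' => ((Lc : ℝ) ^ 4 * (Lc : ℝ) ^ (2 * (3 + 1))) ^ (k - i) •
            (push₃ (legChain (fun j => legComp (fun α x κ u => psiKS (ctrOff (3 + 1) Lc) Lc u x (Sum.inl κ) (Sum.inl α)) (respStepBmSeq (d := 3) (ctr (3 + 1) Lc) Lc j)) i (k - 1 - i)) (legChain (fun j => legComp (fun α x κ u => psiKS (ctrOff (3 + 1) Lc) Lc u x (Sum.inl κ) (Sum.inl α)) (respStepBmSeq (d := 3) (ctr (3 + 1) Lc) Lc j)) i (k - 1 - i))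
              (legChain (fun j => legComp (fun α x κ u => psiKS (ctrOff (3 + 1) Lc) Lc u x (Sum.inl κ) (Sum.inl α)) (respStepBmSeq (d := 3) (ctr (3 + 1) Lc) Lc j)) i (k - 1 - i))
              (unitS (sfStep Lc i) (smStep 3 Lc i) (combFreshAt (symTablesAn1S2 3 Lc cΛ) 0 cΛ i)) κ' u'
              - push₃ (respStep (d := 3) (Lc ^ i) (Lc ^ k)) (respStep (d := 3) (Lc ^ i) (Lc ^ k)) (respStep (d := 3) (Lc ^ i) (Lc ^ k))
              (unitS (sfStep Lc i) (smStep 3 Lc i) (combFreshAt (symTablesAn1S2 3 Lc cΛ) 0 cΛ i)) κ' u')) κ u)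
        (CPc * ((((k - i : ℕ) : ℝ)) ^ q * Θc ^ k)))
    (hCv : ∃ C θ δ : ℝ, 0 ≤ C ∧ 0 ≤ θ ∧ θ < 1 ∧ 0 < δ ∧ ∀ k i : ℕ, i < k →
      LocStencil (transport (combUnitStepMap Lc ((Lc : ℝ) ^ 4)) (i + 1) (k - 1 - i) (combUnitStepMap Lc ((Lc : ℝ) ^ 4) i (fun κ u => (-((Lc : ℝ) ^ 8 / 2)) • (symTablesAn1S2 3 Lc cΛ).V κ u))
        - (fun κ' u' => ((Lc : ℝ) ^ 4 * (Lc : ℝ) ^ (2 * (3 + 1))) ^ (k - i) •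
          push₃ (respStep (d := 3) (Lc ^ (i + 1)) (Lc ^ k)) (respStep (d := 3) (Lc ^ (i + 1)) (Lc ^ k)) (respStep (d := 3) (Lc ^ (i + 1)) (Lc ^ k))
            (fun κ u => -(push₃ (-respStep (d := 3) (Lc ^ i) (Lc ^ (i + 1))) (colM (KStepUnit (d := 3) Lc i) Lc)
                  (respStep (d := 3) (Lc ^ i) (Lc ^ (i + 1))) (reslot Sum.inl Sum.inr fun κ u => (-((Lc : ℝ) ^ 8 / 2)) • SymTables.V (symTablesAn1S2 3 Lc cΛ) κ u) κ u
              + push₃ (rowMM (KStepUnit (d := 3) Lc i) Lc) (respStep (d := 3) (Lc ^ i) (Lc ^ (i + 1)))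
                  (respStep (d := 3) (Lc ^ i) (Lc ^ (i + 1))) (reslot Sum.inr Sum.inl fun κ u => (-((Lc : ℝ) ^ 8 / 2)) • SymTables.V (symTablesAn1S2 3 Lc cΛ) κ u) κ u)) κ' u')) (C * ((((k - i : ℕ) : ℝ)) ^ p * θ ^ (k - i))) δ)
    (hPcV : ∃ CPc Θc : ℝ, 0 ≤ CPc ∧ 0 ≤ Θc ∧ Θc < 1 ∧ ∀ k i : ℕ, 1 ≤ i → i < k → ∀ κ u,
      SupBound
        (((transport (combUnitStepMap Lc ((Lc : ℝ) ^ 4)) (i + 1 + 1) (k - 1 - i) (combUnitStepMap Lc ((Lc : ℝ) ^ 4) (i + 1) (fun κ u => (-((Lc : ℝ) ^ 8 / 2)) • (symTablesAn1S2 3 Lc cΛ).V κ u))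
            - (fun κ' u' => ((Lc : ℝ) ^ 4 * (Lc : ℝ) ^ (2 * (3 + 1))) ^ (k - i) •
          push₃ (respStep (d := 3) (Lc ^ ((i + 1) + 1)) (Lc ^ (k + 1))) (respStep (d := 3) (Lc ^ ((i + 1) + 1)) (Lc ^ (k + 1))) (respStep (d := 3) (Lc ^ ((i + 1) + 1)) (Lc ^ (k + 1)))
            (fun κ u => -(push₃ (-respStep (d := 3) (Lc ^ (i + 1)) (Lc ^ ((i + 1) + 1))) (colM (KStepUnit (d := 3) Lc (i + 1)) Lc)
                  (respStep (d := 3) (Lc ^ (i + 1)) (Lc ^ ((i + 1) + 1))) (reslot Sum.inl Sum.inr fun κ u => (-((Lc : ℝ) ^ 8 / 2)) • SymTables.V (symTablesAn1S2 3 Lc cΛ) κ u) κ u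
              + push₃ (rowMM (KStepUnit (d := 3) Lc (i + 1)) Lc) (respStep (d := 3) (Lc ^ (i + 1)) (Lc ^ ((i + 1) + 1)))
                  (respStep (d := 3) (Lc ^ (i + 1)) (Lc ^ ((i + 1) + 1))) (reslot Sum.inr Sum.inl fun κ u => (-((Lc : ℝ) ^ 8 / 2)) • SymTables.V (symTablesAn1S2 3 Lc cΛ) κ u) κ u)) κ' u'))
          - (transport (combUnitStepMap Lc ((Lc : ℝ) ^ 4)) (i + 1) (k - 1 - i) (combUnitStepMap Lc ((Lc : ℝ) ^ 4) i (fun κ u => (-((Lc : ℝ) ^ 8 / 2)) • (symTablesAn1S2 3 Lc cΛ).V κ u))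
            - (fun κ' u' => ((Lc : ℝ) ^ 4 * (Lc : ℝ) ^ (2 * (3 + 1))) ^ (k - i) •
          push₃ (respStep (d := 3) (Lc ^ (i + 1)) (Lc ^ k)) (respStep (d := 3) (Lc ^ (i + 1)) (Lc ^ k)) (respStep (d := 3) (Lc ^ (i + 1)) (Lc ^ k))
            (fun κ u => -(push₃ (-respStep (d := 3) (Lc ^ i) (Lc ^ (i + 1))) (colM (KStepUnit (d := 3) Lc i) Lc)
                  (respStep (d := 3) (Lc ^ i) (Lc ^ (i + 1))) (reslot Sum.inl Sum.inr fun κ u => (-((Lc : ℝ) ^ 8 / 2)) • SymTables.V (symTablesAn1S2 3 Lc cΛ) κ u) κ u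
              + push₃ (rowMM (KStepUnit (d := 3) Lc i) Lc) (respStep (d := 3) (Lc ^ i) (Lc ^ (i + 1)))
                  (respStep (d := 3) (Lc ^ i) (Lc ^ (i + 1))) (reslot Sum.inr Sum.inl fun κ u => (-((Lc : ℝ) ^ 8 / 2)) • SymTables.V (symTablesAn1S2 3 Lc cΛ) κ u) κ u)) κ' u'))) κ u)
        (CPc * ((((k - i : ℕ) : ℝ)) ^ q * Θc ^ k)))
    (hC : ∀ l : ℕ, (∀ κ κ' κ₁ κ₂, zmode Lc ((((1 : ℝ) / 2) • ((fun κ u κ' u' => (((Lc : ℝ) ^ 8) * (Lc : ℝ) ^ (2 * (3 + 1))) • mmRead Lc (K3OfK (unitK (sfStep Lc l) (smStep 3 Lc l) (GcombSh (d := 3) Lc l)) Lc (unitS (sfStep Lc l) (smStep 3 Lc l) (SpureCombOf (symTablesAn1S2 3 Lc cΛ) ((Lc : ℝ) ^ 4) (-((Lc : ℝ) ^ 8 / 2)) cΛ l)) (unitM (sfStep Lc l) (smStep 3 Lc l) ((symTablesAn1S2 3 Lc cΛ).M l)) (W2SymOfK (unitK (sfStep Lc l) (smStep 3 Lc l) (GcombSh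 (d := 3) Lc l)) Lc (unitS (sfStep Lc l) (smStep 3 Lc l) (SpureCombOf (symTablesAn1S2 3 Lc cΛ) ((Lc : ℝ) ^ 4) (-((Lc : ℝ) ^ 8 / 2)) cΛ l)) (unitM (sfStep Lc l) (smStep 3 Lc l) ((symTablesAn1S2 3 Lc cΛ).M l)) 0 (unitM₂ (sfStep Lc l) (smStep 3 Lc l) (M2Of 3 Lc (symTablesAn1S2 3 Lc cΛ).mixFF l))) κ u κ' u') + cB • (symTablesAn1S2 3 Lc cΛ).vh₂S κ u κ' u') + fun κ u κ' u' => sgnK (trK ((((Lc : ℝ) ^ 8) * (Lc : ℝ) ^ (2 * (3 + 1))) • mmRead Lc (K3OfK (unitK (sfStep Lc l) (smStep 3 Lc l) (GcombSh (d := 3) Lc l)) Lc (unitS (sfStep Lc l) (smStep 3 Lc l) (SpureCombOf (symTablesAn1S2 3 Lc cΛ) ((Lc : ℝ) ^ 4) (-((Lc : ℝ) ^ 8 / 2)) cΛ l)) (unitM (sfStep Lc l) (smStep 3 Lc l) ((symTablesAn1S2 3 Lc cΛ).M l)) (W2SymOfK (unitK (sfStep Lc l) (smStep 3 Lc l) (GcombSh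 (d := 3) Lc l)) Lc (unitS (sfStep Lc l) (smStep 3 Lc l) (SpureCombOf (symTablesAn1S2 3 Lc cΛ) ((Lc : ℝ) ^ 4) (-((Lc : ℝ) ^ 8 / 2)) cΛ l)) (unitM (sfStep Lc l) (smStep 3 Lc l) ((symTablesAn1S2 3 Lc cΛ).M l)) 0 (unitM₂ (sfStep Lc l) (smStep 3 Lc l) (M2Of 3 Lc (symTablesAn1S2 3 Lc cΛ).mixFF l))) κ u κ' u') + cB • (symTablesAn1S2 3 Lc cΛ).vh₂S κ u κ' u')))) +
          (lin4 (((Lc : ℝ) ^ 8) * (Lc : ℝ) ^ (2 * (3 + 1))) (unitK (sfStep Lc l) (smStep 3 Lc l) (GcombSh (d := 3) Lc l)) Lc (((1 : ℝ) / 2) • (unitS₂ (sfStep Lc l) (smStep 3 Lc l) (T2RecOf 3 Lc (GcombSh Lc) (SpureCombOf (symTablesAn1S2 3 Lc cΛ) ((Lc : ℝ) ^ 4) (-((Lc : ℝ) ^ 8 / 2)) cΛ) (symTablesAn1S2 3 Lc cΛ).M ((Lc : ℝ) ^ 8) cB ((8 * (N : ℝ) ^ 2)⁻¹ • wsym22 N)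 (symTablesAn1S2 3 Lc cΛ).vh₂S (symTablesAn1S2 3 Lc cΛ).mixFF l) + fun κ u κ' u' => sgnK (trK ((unitS₂ (sfStep Lc l) (smStep 3 Lc l) (T2RecOf 3 Lc (GcombSh Lc) (SpureCombOf (symTablesAn1S2 3 Lc cΛ) ((Lc : ℝ) ^ 4) (-((Lc : ℝ) ^ 8 / 2)) cΛ) (symTablesAn1S2 3 Lc cΛ).M ((Lc : ℝ) ^ 8) cB ((8 * (N : ℝ) ^ 2)⁻¹ • wsym22 N) (symTablesAn1S2 3 Lc cΛ).vh₂S (symTablesAn1S2 3 Lc cΛ).mixFF l)) κ u κ' u'))))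
          - lin4 (((Lc : ℝ) ^ 8) * (Lc : ℝ) ^ (2 * (3 + 1))) (unitK (sfStep Lc l) (smStep 3 Lc l) (KInvStep (d := 3) Lc l)) Lc (((1 : ℝ) / 2) • (unitS₂ (sfStep Lc l) (smStep 3 Lc l) (T2RecOf 3 Lc (GcombSh Lc) (SpureCombOf (symTablesAn1S2 3 Lc cΛ) ((Lc : ℝ) ^ 4) (-((Lc : ℝ) ^ 8 / 2)) cΛ) (symTablesAn1S2 3 Lc cΛ).M ((Lc : ℝ) ^ 8) cB ((8 * (N : ℝ) ^ 2)⁻¹ • wsym22 N) (symTablesAn1S2 3 Lc cΛ).vh₂S (symTablesAn1S2 3 Lc cΛ).mixFF l) + fun κ u κ' u' => sgnK (trK ((unitS₂ (sfStep Lc l) (smStep 3 Lc l) (T2RecOf 3 Lc (GcombSh Lc) (SpureCombOf (symTablesAn1S2 3 Lc cΛ) ((Lc : ℝ) ^ 4) (-((Lc : ℝ) ^ 8 / 2)) cΛ) (symTablesAn1S2 3 Lc cΛ).M ((Lc : ℝ) ^ 8) cB ((8 * (N : ℝ) ^ 2)⁻¹ • wsym22 N) (symTablesAn1S2 3 Lc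 cΛ).vh₂S (symTablesAn1S2 3 Lc cΛ).mixFF l)) κ u κ' u')))))) κ κ' (Sum.inl κ₁) (Sum.inl κ₂)
        + zmode Lc ((((1 : ℝ) / 2) • ((fun κ u κ' u' => (((Lc : ℝ) ^ 8) * (Lc : ℝ) ^ (2 * (3 + 1))) • mmRead Lc (K3OfK (unitK (sfStep Lc l) (smStep 3 Lc l) (GcombSh (d := 3) Lc l)) Lc (unitS (sfStep Lc l) (smStep 3 Lc l) (SpureCombOf (symTablesAn1S2 3 Lc cΛ) ((Lc : ℝ) ^ 4) (-((Lc : ℝ) ^ 8 / 2)) cΛ l)) (unitM (sfStep Lc l) (smStep 3 Lc l) ((symTablesAn1S2 3 Lc cΛ).M l)) (W2SymOfK (unitK (sfStep Lc l) (smStep 3 Lc l) (GcombSh (d := 3) Lc l)) Lc (unitS (sfStep Lc l) (smStep 3 Lc l) (SpureCombOf (symTablesAn1S2 3 Lc cΛ) ((Lc : ℝ) ^ 4) (-((Lc : ℝ) ^ 8 / 2)) cΛ l)) (unitM (sfStep Lc l) (smStep 3 Lc l) ((symTablesAn1S2 3 Lc cΛ).M l)) 0 (unitM₂ (sfStep Lc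 l) (smStep 3 Lc l) (M2Of 3 Lc (symTablesAn1S2 3 Lc cΛ).mixFF l))) κ u κ' u') + cB • (symTablesAn1S2 3 Lc cΛ).vh₂S κ u κ' u') + fun κ u κ' u' => sgnK (trK ((((Lc : ℝ) ^ 8) * (Lc : ℝ) ^ (2 * (3 + 1))) • mmRead Lc (K3OfK (unitK (sfStep Lc l) (smStep 3 Lc l) (GcombSh (d := 3) Lc l)) Lc (unitS (sfStep Lc l) (smStep 3 Lc l) (SpureCombOf (symTablesAn1S2 3 Lc cΛ) ((Lc : ℝ) ^ 4) (-((Lc : ℝ) ^ 8 / 2)) cΛ l)) (unitM (sfStep Lc l) (smStep 3 Lc l) ((symTablesAn1S2 3 Lc cΛ).M l)) (W2SymOfK (unitK (sfStep Lc l) (smStep 3 Lc l) (GcombSh (d := 3) Lc l)) Lc (unitS (sfStep Lc l) (smStep 3 Lc l) (SpureCombOf (symTablesAn1S2 3 Lc cΛ) ((Lc : ℝ) ^ 4) (-((Lc : ℝ) ^ 8 / 2)) cΛ l)) (unitM (sfStep Lc l) (smStep 3 Lc l) ((symTablesAn1S2 3 Lc cΛ).M l)) 0 (unitM₂ (sfStep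 Lc l) (smStep 3 Lc l) (M2Of 3 Lc (symTablesAn1S2 3 Lc cΛ).mixFF l))) κ u κ' u') + cB • (symTablesAn1S2 3 Lc cΛ).vh₂S κ u κ' u')))) +
          (lin4 (((Lc : ℝ) ^ 8) * (Lc : ℝ) ^ (2 * (3 + 1))) (unitK (sfStep Lc l) (smStep 3 Lc l) (GcombSh (d := 3) Lc l)) Lc (((1 : ℝ) / 2) • (unitS₂ (sfStep Lc l) (smStep 3 Lc l) (T2RecOf 3 Lc (GcombSh Lc) (SpureCombOf (symTablesAn1S2 3 Lc cΛ) ((Lc : ℝ) ^ 4) (-((Lc : ℝ) ^ 8 / 2)) cΛ) (symTablesAn1S2 3 Lc cΛ).M ((Lc : ℝ) ^ 8) cB ((8 * (N : ℝ) ^ 2)⁻¹ • wsym22 N) (symTablesAn1S2 3 Lc cΛ).vh₂S (symTablesAn1S2 3 Lc cΛ).mixFF l) + fun κ u κ' u' => sgnK (trK ((unitS₂ (sfStep Lc l) (smStep 3 Lc l) (T2RecOf 3 Lc (GcombSh Lc) (SpureCombOf (symTablesAn1S2 3 Lc cΛ) ((Lc : ℝ) ^ 4) (-((Lc : ℝ)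 ^ 8 / 2)) cΛ) (symTablesAn1S2 3 Lc cΛ).M ((Lc : ℝ) ^ 8) cB ((8 * (N : ℝ) ^ 2)⁻¹ • wsym22 N) (symTablesAn1S2 3 Lc cΛ).vh₂S (symTablesAn1S2 3 Lc cΛ).mixFF l)) κ u κ' u'))))
          - lin4 (((Lc : ℝ) ^ 8) * (Lc : ℝ) ^ (2 * (3 + 1))) (unitK (sfStep Lc l) (smStep 3 Lc l) (KInvStep (d := 3) Lc l)) Lc (((1 : ℝ) / 2) • (unitS₂ (sfStep Lc l) (smStep 3 Lc l) (T2RecOf 3 Lc (GcombSh Lc) (SpureCombOf (symTablesAn1S2 3 Lc cΛ) ((Lc : ℝ) ^ 4) (-((Lc : ℝ) ^ 8 / 2)) cΛ) (symTablesAn1S2 3 Lc cΛ).M ((Lc : ℝ) ^ 8) cB ((8 * (N : ℝ) ^ 2)⁻¹ • wsym22 N) (symTablesAn1S2 3 Lc cΛ).vh₂S (symTablesAn1S2 3 Lc cΛ).mixFF l) + fun κ u κ' u' => sgnK (trK ((unitS₂ (sfStep Lc l) (smStep 3 Lc l) (T2RecOf 3 Lc (GcombSh Lc) (SpureCombOf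 (symTablesAn1S2 3 Lc cΛ) ((Lc : ℝ) ^ 4) (-((Lc : ℝ) ^ 8 / 2)) cΛ) (symTablesAn1S2 3 Lc cΛ).M ((Lc : ℝ) ^ 8) cB ((8 * (N : ℝ) ^ 2)⁻¹ • wsym22 N) (symTablesAn1S2 3 Lc cΛ).vh₂S (symTablesAn1S2 3 Lc cΛ).mixFF l)) κ u κ' u')))))) κ' κ (Sum.inl κ₁) (Sum.inl κ₂) = 0))
    (μ ν : Fin 4) :
    ∃ κ θ : ℝ, 0 ≤ θ ∧ θ < 1 ∧ AllScalesSeq (fun j => B12Beta.secondMoment (TbalOf Lc (JsB12CombShSym hLc N (symTablesAn1S2 3 Lc cΛ) cΛ cB) j) μ ν) κ θ := by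
  obtain ⟨R, R'', hTL, hTL'', hCm, hR, hR''⟩ := exists_tableLaws_parities_comb_three_at_pin (Lc := Lc) hLc hN hΛ
    (cE := (Lc : ℝ) ^ 4) (cVH := -((Lc : ℝ) ^ 8 / 2)) (cE₂ := (Lc : ℝ) ^ 8) (by norm_num) (by ring) rfl hcB
    (Tc := (8 * (N : ℝ) ^ 2)⁻¹ • wsym22 N) rfl
  exact exists_allScalesSeq_JsB12CombShSym_an1_of_contactLetters_letterRows hLc hLc2 N cΛ cΛ cB (1 / 2 : ℝ) hCT hCTd hCg hPc hCv hPcV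
    (ctrOff_mem_box (le_trans one_le_two hLc2)) hcH0_pin_three hcH_pin_three hq_pin_three hTL hTL'' hCm hR hR'' hC μ ν

end Summit.QuantumFields.BalabanUV.Beta.GAN24.CombTowerEndAtPin

end
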